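import Mathlib.Analysis.SpecificLimits.Normed
import Mathlib.LinearAlgebra.Dual.Lemmas
import Mathlib.LinearAlgebra.Dimension.StrongRankCondition
import Literature.Computability.AlgebraicComplexity.AsymptoticRankZariskiClosed
import Literature.Computability.AlgebraicComplexity.GroupAlgebraTensor
import Literature.Computability.AlgebraicComplexity.CoppersmithWinograd1990Proofs
import HarnessLib

/-!
# Sublevel sets of the asymptotic rank are Zariski-closed — proof (CHNVZ 2025, Thm 1.2, `k = 3`)

Topic `Literature/Computability/AlgebraicComplexity`; sibling of `AsymptoticRankZariskiClosed.lean`,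
whose named fact `chnvz_zariskiClosed_asymptoticRank_le` (Christandl–Hoeberechts–Nieuwboer–Vrana–
Zuiddam, *Asymptotic tensor rank is characterized by polynomials*, STOC 2025 = arXiv:2411.15789,
**Theorem 1.2** for tensors of order three, with the Zariski closure of §2.2) is DISCHARGED here:
`chnvz_zariskiClosed_asymptoticRank_le_holds`.  Everything in this file is proved; there are no
definitions and no named facts.

## The printed proof (arXiv:2411.15789, §2.2, read from the held text) and its formalisation

The source proves, for any "admissible functional" `F = (F_n)` on the tensor powers of a vector
space `V` (subadditive, submultiplicative, permutation invariant, scaling invariant, `F_1`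
bounded — tensor rank of Kronecker powers being the main example) with regularisation
`F̃(T) = lim_n F_n(T^{⊗n})^{1/n} = inf_n …`:

* **Lemma 2.3**: `Ā^{(n)} ⊆ span A^{(n)}` — if `T` is in the Zariski closure of `A` then `T^{⊗n}`
  is a linear combination of the `S^{⊗n}`, `S ∈ A` ("for every linear form `ℓ` … define
  `f(T) = ℓ(T^{⊗n})`; then `f` is a polynomial function on `V` and `f|_A ≡ 0`").  Here:
  `kroneckerPow_mem_span_of_forall_eval_eq_zero` (the span is the double annihilator,
  `Subspace.dualAnnihilator_dualCoannihilator_eq`; the polynomial is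
  `∑_x φ(E_x) ∏_i X_{x(i)}` for the indicator tensors `E_x` of the power format).
* **Theorem 2.2** (`F̃[Ā] = F̃[A]`): write `T^{⊗n} = ∑_{i ≤ ν(n)} α_i S_i^{⊗n}` with linearly
  independent `S_i^{⊗n}`, so that `ν(n) ≤ dim Sym^n V` grows polynomially; expand `T^{⊗nm}`,
  use subadditivity, submultiplicativity and the REARRANGEMENT
  `F(⊗_j S_{i_j}^{⊗n}) = F(⊗_i S_i^{⊗ m_i n}) ≤ ∏_i F(S_i^{⊗ m_i n})`, bound
  `F(S_i^{⊗ℓ}) ≤ C_i (F̃[A] + ε)^ℓ`, and let `m → ∞`, `ε → 0`, `n → ∞`.  Here, for tensor rank: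
  `finrank_span_kroneckerPow_le` (the polynomial bound, in the cruder but sufficient form
  `ν(n) ≤ (n+1)^{dim V}`: the entries of `S^{⊗n}` only depend on the multiplicities of the
  coordinates among the `n` positions), `exists_eq_sum_smul_kroneckerPow` (few terms, via
  `Submodule.exists_fun_fin_finrank_span_eq`), `tensorRank_kroneckerPi_le_prod_fiber` (the
  rearrangement, via the product bound `tensorRank_le_prod_of_forall_eq`),
  `exists_const_tensorRank_kroneckerPow_le` (`R(S^{⊗ℓ}) ≤ C ρ^ℓ` once `R̃(S) < ρ`, from one power
  by submultiplicativity `tensorRank_kroneckerPow_add_le` and the format bound), and the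
  double-blocking estimate `tensorRank_kroneckerPow_mul_le_of_eq_sum`:
  `R(T^{⊗(mn)}) ≤ ν^m (∏_i C_i) ρ^{mn}`.
* **Corollary 2.4**: with `A = {R̃ ≤ r}`, `F̃[Ā] ≤ r`, i.e. `Ā ⊆ A`.  Here the limits are replaced
  by explicit choices: given `δ > 0` put `ρ = r + δ/2`, pick `n` with `(n+1)^{dim V} ρ^n < (r+δ)^n`
  (`exists_pow_succ_lt_pow`) and then `m` with `∏ C_i ≤ γ^m`, `γ = (r+δ)^n / (ν ρ^n) > 1`
  (`exists_le_pow_of_one_lt`); the term `N + 1 = mn` of the infimum defining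
  `asymptoticRank T` is then `≤ r + δ` — `chnvz_zariskiClosed_asymptoticRank_le_holds`.
  (`r < 0` is vacuous: the constant polynomial `1` vanishes on the empty sublevel set.)

Deviations from the printed text: none in substance; the tree's `asymptoticRank` is the infimum
`inf_N R(T^{⊗(N+1)})^{1/(N+1)}` (equal to the limit by Fekete, `AsymptoticRankLimit.lean`), which is
all the argument needs, and `dim Sym^n V` is replaced by the bound `(n+1)^{dim V}`.

## References

* M. Christandl, K. Hoeberechts, H. Nieuwboer, P. Vrana, J. Zuiddam, *Asymptotic tensor rank is
  characterized by polynomials*, Proc. 57th ACM STOC (2025) 750–755, doi:10.1145/3717823.3718122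
  = arXiv:2411.15789 (held: `paper:arxiv-2411.15789`), §2.2: Lemma 2.3, Theorem 2.2,
  Corollary 2.4; Theorem 1.2. [ChristandlHoeberechtsNieuwboerVranaZuiddam2025]
* M. Bläser, *Fast Matrix Multiplication*, Theory of Computing Graduate Surveys 5 (2013), §4,
  Lemma 5.4, Lemma 5.8 (rank calculus used from `KroneckerRank`, `TensorRankFactsProofs`,
  `GroupAlgebraTensor`, `CoppersmithWinograd1990Proofs`). [Blaser2013]
-/

noncomputable section

open scoped BigOperators
open Filter

namespace Literature.Computability.AlgebraicComplexity

/-! ## A. Rank toolkit -/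

section Toolkit

variable {K : Type*} [CommSemiring K] {ι κ μ : Type*}

/-- Scaling does not increase the rank: `R(c • t) ≤ R(t)` (scale the first vector of each
triad). [folklore] -/
theorem tensorRank_smul_le [Fintype ι] [Fintype κ] [Fintype μ] (c : K)
    (t : ι → κ → μ → K) : tensorRank (c • t) ≤ tensorRank t := by
  obtain ⟨w, u, v, h⟩ := exists_triad_decomposition_tensorRank t
  refine tensorRank_le_of_eq_sum (fun i a => c * w i a) u v ?_
  funext x y z
  rw [Pi.smul_apply, Pi.smul_apply, Pi.smul_apply, smul_eq_mul, sum_triad_apply]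
  conv_lhs => rw [h]
  rw [sum_triad_apply, Finset.mul_sum]
  exact Finset.sum_congr rfl fun i _ => by ring

/-- Entrywise form of `tensorRank_precomp_le`: a tensor whose entries are those of `t` read off
along index maps `f, g, h` has rank at most `R(t)`. [folklore] -/
theorem tensorRank_le_of_eq_precomp [Fintype ι] [Fintype κ] [Fintype μ] {ι' κ' μ' : Type*}
    (t : ι → κ → μ → K) (f : ι' → ι) (g : κ' → κ) (h : μ' → μ) (s : ι' → κ' → μ' → K)
    (hs : ∀ a b c, s a b c = t (f a) (g b) (h c)) : tensorRank s ≤ tensorRank t := by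
  have : s = fun a b c => t (f a) (g b) (h c) := by
    funext a b c
    exact hs a b c
  rw [this]
  exact tensorRank_precomp_le t f g h

/-- **Rank of a Kronecker product of a finite family is at most the product of the ranks**, in
the entrywise form used for regrouping: if `s (a, b, c) = ∏_β t_β (f a β) (g b β) (h c β)` for
index maps into the product formats, then `R(s) ≤ ∏_β R(t_β)` (multiply out optimal
decompositions of the `t_β`; Bläser 2013, Lemma 5.8 for two factors). [folklore] -/
theorem tensorRank_le_prod_of_forall_eq {B : Type*} [Fintype B] [DecidableEq B]
    {X Y Z : B → Type*} [∀ b, Fintype (X b)] [∀ b, Fintype (Y b)] [∀ b, Fintype (Z b)]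
    (t : ∀ b, X b → Y b → Z b → K) {ι' κ' μ' : Type*} (f : ι' → ∀ b, X b)
    (g : κ' → ∀ b, Y b) (h : μ' → ∀ b, Z b) (s : ι' → κ' → μ' → K)
    (hs : ∀ a b' c, s a b' c = ∏ b, t b (f a b) (g b' b) (h c b)) :
    tensorRank s ≤ ∏ b, tensorRank (t b) := by
  have hdec := fun b => exists_triad_decomposition_tensorRank (t b)
  choose w u v hwuv using hdec
  have hcard : Fintype.card (∀ b, Fin (tensorRank (t b))) = ∏ b, tensorRank (t b) := by
    rw [Fintype.card_pi]
    simp only [Fintype.card_fin]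
  rw [← hcard]
  refine tensorRank_le_card_of_eq_sum (fun σ a => ∏ b, w b (σ b) (f a b))
    (fun σ b' => ∏ b, u b (σ b) (g b' b)) (fun σ c => ∏ b, v b (σ b) (h c b)) ?_
  funext a b' c
  rw [Finset.sum_apply, Finset.sum_apply, Finset.sum_apply, hs]
  simp only [triad_apply]
  have hentry : ∀ b, t b (f a b) (g b' b) (h c b) =
      ∑ i, w b i (f a b) * u b i (g b' b) * v b i (h c b) := fun b => by
    conv_lhs => rw [hwuv b]
    exact sum_triad_apply _ _ _ _ _ _
  rw [Finset.prod_congr rfl fun b _ => hentry b, Fintype.prod_sum]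
  refine Finset.sum_congr rfl fun σ _ => ?_
  rw [Finset.prod_mul_distrib, Finset.prod_mul_distrib]

/-- **Regrouping equal factors** (the rearrangement step in the proof of CHNVZ Thm 2.2): for a
colouring `J : Fin m → B` and tensors `S_b`, the Kronecker product `⊗_l S_{J l}^{⊗n}` has rank at
most `∏_b R(S_b^{⊗(#J⁻¹(b)·n)})`.
[cite: ChristandlHoeberechtsNieuwboerVranaZuiddam2025, Theorem 2.2 (proof)] -/
theorem tensorRank_kroneckerPi_le_prod_fiber [Fintype ι] [Fintype κ] [Fintype μ] {B : Type*}
    [Fintype B] [DecidableEq B] {m : ℕ} (J : Fin m → B) (n : ℕ) (S : B → ι → κ → μ → K) :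
    tensorRank (kroneckerPi fun l => kroneckerPow (S (J l)) n) ≤
      ∏ b, tensorRank (kroneckerPow (S b) (Fintype.card {l // J l = b} * n)) := by
  classical
  -- the grouped factors `Y b = ⊗_{l ∈ J⁻¹(b)} S_{J l}^{⊗ n}` on index types `J⁻¹(b) → Fin n → ι`
  set Y : ∀ b : B, ({l // J l = b} → Fin n → ι) → ({l // J l = b} → Fin n → κ) →
      ({l // J l = b} → Fin n → μ) → K :=
    fun b a' b' c' => ∏ l, ∏ i, S (J l.1) (a' l i) (b' l i) (c' l i) with hY
  have h1 : tensorRank (kroneckerPi fun l => kroneckerPow (S (J l)) n) ≤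
      ∏ b, tensorRank (Y b) := by
    refine tensorRank_le_prod_of_forall_eq Y (fun a b l => a l.1) (fun b' b l => b' l.1)
      (fun c b l => c l.1) _ fun a b' c => ?_
    simp only [kroneckerPi_apply, kroneckerPow_apply, hY]
    exact (Fintype.prod_fiberwise J _).symm
  refine h1.trans (Finset.prod_le_prod (fun _ _ => Nat.zero_le _) fun b _ => ?_)
  -- `Y b` is `S_b^{⊗(#J⁻¹(b)·n)}` read off along a bijection `J⁻¹(b) × Fin n ≃ Fin (#J⁻¹(b)·n)`
  have e : {l // J l = b} × Fin n ≃ Fin (Fintype.card {l // J l = b} * n) :=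
    Fintype.equivFinOfCardEq (by simp)
  refine tensorRank_le_of_eq_precomp (kroneckerPow (S b) _)
    (fun a' i => a' (e.symm i).1 (e.symm i).2) (fun b' i => b' (e.symm i).1 (e.symm i).2)
    (fun c' i => c' (e.symm i).1 (e.symm i).2) (Y b) fun a' b' c' => ?_
  simp only [hY, kroneckerPow_apply]
  rw [← Fintype.prod_prod_type' (f := fun l i => S (J l.1) (a' l i) (b' l i) (c' l i))]
  refine Fintype.prod_equiv e _ _ fun p => ?_
  simp only [Equiv.symm_apply_apply]
  rw [p.1.2]

/-- Scalars pull out of a Kronecker product of a family. [folklore] -/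
theorem kroneckerPi_smul {N : ℕ} (α : Fin N → K) (t : Fin N → ι → κ → μ → K) :
    (kroneckerPi fun l => α l • t l) = (∏ l, α l) • kroneckerPi t := by
  funext a b c
  simp only [kroneckerPi_apply, Pi.smul_apply, smul_eq_mul]
  exact Finset.prod_mul_distrib

/-- `t^{⊗(m n)}` is `(t^{⊗ n})^{⊗ m}` read off along `Fin m × Fin n ≃ Fin (m n)`, hence
`R(t^{⊗(m n)}) ≤ R((t^{⊗n})^{⊗m})`. [folklore] -/
theorem tensorRank_kroneckerPow_mul_le_pow_pow [Fintype ι] [Fintype κ] [Fintype μ]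
    (t : ι → κ → μ → K) (m n : ℕ) :
    tensorRank (kroneckerPow t (m * n)) ≤ tensorRank (kroneckerPow (kroneckerPow t n) m) := by
  refine tensorRank_le_of_eq_precomp (kroneckerPow (kroneckerPow t n) m)
    (fun a j i => a (finProdFinEquiv (j, i))) (fun b j i => b (finProdFinEquiv (j, i)))
    (fun c j i => c (finProdFinEquiv (j, i))) _ fun a b c => ?_
  simp only [kroneckerPow_apply]
  rw [← Fintype.prod_prod_type' (f := fun j i =>
    t (a (finProdFinEquiv (j, i))) (b (finProdFinEquiv (j, i))) (c (finProdFinEquiv (j, i))))]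
  exact Fintype.prod_equiv finProdFinEquiv.symm _ _ fun x => by
    simp only [Prod.mk.eta, Equiv.apply_symm_apply]

end Toolkit

/-! ## D. Growth of the ranks of the powers from one power -/

section Growth

variable {F : Type*} [Field F] {ι κ μ : Type*} [Fintype ι] [Fintype κ] [Fintype μ]

/-- Format bound for powers: `R(S^{⊗ j}) ≤ (|ι| |κ| |μ|)^j`. [folklore] -/
theorem tensorRank_kroneckerPow_le_card_pow (S : ι → κ → μ → F) (j : ℕ) :
    tensorRank (kroneckerPow S j) ≤ (Fintype.card ι * Fintype.card κ * Fintype.card μ) ^ j := by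
  classical
  refine (tensorRank_le_card _).trans_eq ?_
  simp only [Fintype.card_fun, Fintype.card_fin]
  ring

/-- **Growth from one power**: if `R̃(S) < ρ` then `R(S^{⊗ℓ}) ≤ C ρ^ℓ` for all `ℓ`, for some
constant `C ≥ 1` (pick `M` with `R(S^{⊗M}) < ρ^M`, write `ℓ = Mq + j`, use submultiplicativity
and the format bound on the remainder; the source's `M(ε, n)`).
[cite: ChristandlHoeberechtsNieuwboerVranaZuiddam2025, Theorem 2.2 (proof)] -/
theorem exists_const_tensorRank_kroneckerPow_le (S : ι → κ → μ → F) {ρ : ℝ} (hρ : 0 < ρ)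
    (hS : asymptoticRank S < ρ) :
    ∃ C : ℝ, 1 ≤ C ∧ ∀ ℓ : ℕ, (tensorRank (kroneckerPow S ℓ) : ℝ) ≤ C * ρ ^ ℓ := by
  classical
  unfold asymptoticRank at hS
  obtain ⟨N, hN⟩ := exists_lt_of_ciInf_lt hS
  have h0 : (0 : ℝ) ≤ tensorRank (kroneckerPow S (N + 1)) := Nat.cast_nonneg _
  have hRM : (tensorRank (kroneckerPow S (N + 1)) : ℝ) < ρ ^ (N + 1) := by
    have := pow_lt_pow_left₀ hN (Real.rpow_nonneg h0 _) (Nat.succ_ne_zero N)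
    rwa [show ((N : ℝ) + 1)⁻¹ = ((N + 1 : ℕ) : ℝ)⁻¹ by push_cast; ring,
      Real.rpow_inv_natCast_pow h0 (Nat.succ_ne_zero N)] at this
  set Kc : ℕ := Fintype.card ι * Fintype.card κ * Fintype.card μ with hKc
  refine ⟨(max 1 (Kc / ρ)) ^ (N + 1), one_le_pow₀ (le_max_left _ _), fun ℓ => ?_⟩
  obtain ⟨q, j, hj, rfl⟩ : ∃ q j, j < N + 1 ∧ ℓ = (N + 1) * q + j :=
    ⟨ℓ / (N + 1), ℓ % (N + 1), Nat.mod_lt _ (Nat.succ_pos N),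
      (Nat.div_add_mod ℓ (N + 1)).symm⟩
  have hnat : tensorRank (kroneckerPow S ((N + 1) * q + j)) ≤
      tensorRank (kroneckerPow S (N + 1)) ^ q * Kc ^ j :=
    (tensorRank_kroneckerPow_add_le S _ _).trans
      (Nat.mul_le_mul (tensorRank_kroneckerPow_mul_le_pow S (N + 1) q)
        (tensorRank_kroneckerPow_le_card_pow S j))
  have hKρ : (Kc : ℝ) ^ j ≤ (max 1 (Kc / ρ)) ^ (N + 1) * ρ ^ j := by
    have : (Kc : ℝ) ^ j = ((Kc : ℝ) / ρ) ^ j * ρ ^ j := by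
      rw [div_pow, div_mul_cancel₀ _ (pow_ne_zero _ hρ.ne')]
    rw [this]
    gcongr
    exact (pow_le_pow_left₀ (by positivity) (le_max_right 1 _) j).trans
      (pow_le_pow_right₀ (le_max_left _ _) hj.le)
  calc (tensorRank (kroneckerPow S ((N + 1) * q + j)) : ℝ)
      ≤ (tensorRank (kroneckerPow S (N + 1)) : ℝ) ^ q * (Kc : ℝ) ^ j := by
        exact_mod_cast hnat
    _ ≤ (ρ ^ (N + 1)) ^ q * ((max 1 (Kc / ρ)) ^ (N + 1) * ρ ^ j) := by gcongr
    _ = (max 1 (Kc / ρ)) ^ (N + 1) * ρ ^ ((N + 1) * q + j) := by ring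

end Growth

/-! ## F. Two elementary facts about real sequences -/

section Reals

/-- Exponentials beat polynomials: for `θ > 1` and `d ∈ ℕ` there is `n ≥ 1` with
`(n + 1)^d < θ^n`. [folklore] -/
theorem exists_pow_succ_lt_pow {θ : ℝ} (hθ : 1 < θ) (d : ℕ) :
    ∃ n : ℕ, 1 ≤ n ∧ ((n : ℝ) + 1) ^ d < θ ^ n := by
  have h := (tendsto_pow_const_div_const_pow_of_one_lt d hθ).comp (tendsto_add_atTop_nat 1)
  have hθ0 : 0 < θ := one_pos.trans hθ
  have hev : ∀ᶠ n : ℕ in atTop, ((n + 1 : ℕ) : ℝ) ^ d / θ ^ (n + 1) < θ⁻¹ :=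
    h.eventually (gt_mem_nhds (inv_pos.2 hθ0))
  obtain ⟨n, hn, hn1⟩ := (hev.and (eventually_ge_atTop 1)).exists
  refine ⟨n, hn1, ?_⟩
  rw [div_lt_iff₀ (pow_pos hθ0 _)] at hn
  have hθn : θ⁻¹ * θ ^ (n + 1) = θ ^ n := by
    rw [pow_succ', ← mul_assoc, inv_mul_cancel₀ hθ0.ne', one_mul]
  rw [hθn] at hn
  exact_mod_cast hn

/-- Powers of `γ > 1` are unbounded: some `m ≥ 1` has `C ≤ γ^m`. [folklore] -/
theorem exists_le_pow_of_one_lt {γ : ℝ} (hγ : 1 < γ) (C : ℝ) :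
    ∃ m : ℕ, 1 ≤ m ∧ C ≤ γ ^ m := by
  obtain ⟨m, hm⟩ := pow_unbounded_of_one_lt C hγ
  exact ⟨m + 1, Nat.succ_pos m, hm.le.trans (pow_le_pow_right₀ hγ.le (Nat.le_succ m))⟩

end Reals

/-! ## B. Lemma 2.3 in coordinates: powers of the closure lie in the span of the powers -/

section Span

open MvPolynomial

variable {F : Type*} [Field F] {ι κ μ : Type*} [Fintype ι] [Fintype κ] [Fintype μ]

/-- **CHNVZ Lemma 2.3** (coordinates, `k = 3`): if every polynomial in the entries vanishing on `A`
vanishes at `T`, then for every `n` the power `T^{⊗n}` lies in the linear span of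
`{S^{⊗n} : S ∈ A}` — a linear form `ℓ` on the power space killing all `S^{⊗n}` yields the
polynomial `f(T) = ℓ(T^{⊗n})` vanishing on `A`, and the span is cut out by such forms.
[cite: ChristandlHoeberechtsNieuwboerVranaZuiddam2025, Lemma 2.3] -/
theorem kroneckerPow_mem_span_of_forall_eval_eq_zero (A : Set (ι → κ → μ → F))
    (T : ι → κ → μ → F)
    (hZ : ∀ p : MvPolynomial (ι × κ × μ) F,
      (∀ S ∈ A, eval (tensorEntries S) p = 0) → eval (tensorEntries T) p = 0)
    (n : ℕ) :
    kroneckerPow T n ∈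
      Submodule.span F ((fun S : ι → κ → μ → F => kroneckerPow S n) '' A) := by
  classical
  set W := Submodule.span F ((fun S : ι → κ → μ → F => kroneckerPow S n) '' A) with hW
  rw [← Subspace.dualAnnihilator_dualCoannihilator_eq (W := W),
    Submodule.mem_dualCoannihilator]
  intro φ hφ
  rw [Submodule.mem_dualAnnihilator] at hφ
  -- indicator tensors of the power format and the expansion of a linear form along them
  set E : (Fin n → ι) × (Fin n → κ) × (Fin n → μ) →
      ((Fin n → ι) → (Fin n → κ) → (Fin n → μ) → F) :=
    fun x a b c => if (a, b, c) = x then 1 else 0 with hE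
  have expand : ∀ v : (Fin n → ι) → (Fin n → κ) → (Fin n → μ) → F,
      v = ∑ x, v x.1 x.2.1 x.2.2 • E x := by
    intro v
    funext a b c
    rw [Finset.sum_apply, Finset.sum_apply, Finset.sum_apply]
    simp only [Pi.smul_apply, smul_eq_mul, hE]
    rw [Fintype.sum_eq_single (a, b, c) fun x hx => by simp [Ne.symm hx]]
    simp
  have hφv : ∀ v : (Fin n → ι) → (Fin n → κ) → (Fin n → μ) → F,
      φ v = ∑ x, v x.1 x.2.1 x.2.2 * φ (E x) := by
    intro v
    conv_lhs => rw [expand v]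
    rw [map_sum]
    simp only [map_smul, smul_eq_mul]
  -- the polynomial `f = φ ((·)^{⊗n})`
  set p : MvPolynomial (ι × κ × μ) F :=
    ∑ x : (Fin n → ι) × (Fin n → κ) × (Fin n → μ),
      C (φ (E x)) * ∏ i, X (x.1 i, x.2.1 i, x.2.2 i) with hp_def
  have hp : ∀ S : ι → κ → μ → F, eval (tensorEntries S) p = φ (kroneckerPow S n) := by
    intro S
    rw [hφv (kroneckerPow S n)]
    simp only [hp_def, map_sum, map_mul, eval_C, map_prod, eval_X, tensorEntries,
      kroneckerPow_apply]
    exact Finset.sum_congr rfl fun x _ => mul_comm _ _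
  have hpA : ∀ S ∈ A, eval (tensorEntries S) p = 0 := fun S hS => by
    rw [hp]
    exact hφ _ (Submodule.subset_span ⟨S, hS, rfl⟩)
  have hT := hZ p hpA
  rwa [hp] at hT

end Span

/-! ## C. The span of the `n`-th powers has dimension polynomial in `n` -/

section Dimension

variable {F : Type*} [Field F] {ι κ μ : Type*} [Fintype ι] [Fintype κ] [Fintype μ]

/-- **Polynomial dimension bound** (the estimate `ν(n) ≤ dim Sym^n V` in the proof of CHNVZ
Thm 2.2, in the cruder form `≤ (n+1)^{dim V}`): the entries of `S^{⊗n}` depend only on how often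
each coordinate `(a, b, c)` occurs among the `n` positions, so all `S^{⊗n}` lie in the range of a
linear map from `F^{(D → Fin (n+1))}`, `D = ι × κ × μ`.
[cite: ChristandlHoeberechtsNieuwboerVranaZuiddam2025, Theorem 2.2 (proof)] -/
theorem finrank_span_kroneckerPow_le (A : Set (ι → κ → μ → F)) (n : ℕ) :
    Module.finrank F (Submodule.span F ((fun S : ι → κ → μ → F => kroneckerPow S n) '' A)) ≤
      (n + 1) ^ Fintype.card (ι × κ × μ) := by
  classical
  -- multiplicity vector of a position triple
  let cnt : (Fin n → ι) → (Fin n → κ) → (Fin n → μ) → (ι × κ × μ → Fin (n + 1)) :=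
    fun a b c d => ⟨(Finset.univ.filter fun i => (a i, b i, c i) = d).card,
      Nat.lt_succ_of_le ((Finset.card_filter_le _ _).trans_eq (Finset.card_fin n))⟩
  let L : ((ι × κ × μ → Fin (n + 1)) → F) →ₗ[F]
      ((Fin n → ι) → (Fin n → κ) → (Fin n → μ) → F) :=
    { toFun := fun g a b c => g (cnt a b c)
      map_add' := fun _ _ => rfl
      map_smul' := fun _ _ => rfl }
  have hrange : (fun S : ι → κ → μ → F => kroneckerPow S n) '' A ⊆ LinearMap.range L := by
    rintro _ ⟨S, -, rfl⟩
    refine ⟨fun m => ∏ d, tensorEntries S d ^ (m d : ℕ), ?_⟩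
    funext a b c
    change (∏ d, tensorEntries S d ^ (cnt a b c d : ℕ)) = kroneckerPow S n a b c
    rw [kroneckerPow_apply]
    calc ∏ d, tensorEntries S d ^ (cnt a b c d : ℕ)
        = ∏ d, ∏ _i ∈ Finset.univ.filter (fun i => (a i, b i, c i) = d),
            tensorEntries S d := by
          refine Finset.prod_congr rfl fun d _ => ?_
          rw [Finset.prod_const]
      _ = ∏ i, tensorEntries S (a i, b i, c i) := Finset.prod_fiberwise' _ _ _
      _ = ∏ i, S (a i) (b i) (c i) := rfl
  calc Module.finrank F (Submodule.span F ((fun S : ι → κ → μ → F => kroneckerPow S n) '' A))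
      ≤ Module.finrank F (LinearMap.range L) :=
        Submodule.finrank_mono (Submodule.span_le.2 hrange)
    _ ≤ Module.finrank F ((ι × κ × μ → Fin (n + 1)) → F) := LinearMap.finrank_range_le L
    _ = (n + 1) ^ Fintype.card (ι × κ × μ) := by
        rw [Module.finrank_fintype_fun_eq_card, Fintype.card_fun, Fintype.card_fin]

/-- **Few terms**: an element of the span of the `n`-th powers of `A` is a combination of at
most `(n+1)^{|ι×κ×μ|}` powers `S_i^{⊗n}`, `S_i ∈ A` (a basis of the span chosen among the
powers). [cite: ChristandlHoeberechtsNieuwboerVranaZuiddam2025, Theorem 2.2 (proof)] -/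
theorem exists_eq_sum_smul_kroneckerPow (A : Set (ι → κ → μ → F)) (n : ℕ)
    {v : (Fin n → ι) → (Fin n → κ) → (Fin n → μ) → F}
    (hv : v ∈ Submodule.span F ((fun S : ι → κ → μ → F => kroneckerPow S n) '' A)) :
    ∃ (ν : ℕ) (S : Fin ν → ι → κ → μ → F) (α : Fin ν → F),
      ν ≤ (n + 1) ^ Fintype.card (ι × κ × μ) ∧ (∀ i, S i ∈ A) ∧
        v = ∑ i, α i • kroneckerPow (S i) n := by
  set s := (fun S : ι → κ → μ → F => kroneckerPow S n) '' A with hs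
  obtain ⟨f, hfs, hspan, -⟩ := Submodule.exists_fun_fin_finrank_span_eq F s
  rw [← hspan, Submodule.mem_span_range_iff_exists_fun] at hv
  obtain ⟨c, hc⟩ := hv
  have hfS : ∀ i, ∃ S ∈ A, kroneckerPow S n = f i := fun i => hfs i
  choose S hSA hSf using hfS
  refine ⟨_, S, c, finrank_span_kroneckerPow_le A n, hSA, ?_⟩
  rw [← hc]
  simp only [hSf]

end Dimension

/-! ## E. The double-blocking estimate -/

section Estimate

variable {F : Type*} [Field F] {ι κ μ : Type*} [Fintype ι] [Fintype κ] [Fintype μ]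

/-- For a colouring `J : Fin m → Fin ν`, the fibre sizes add up to `m`. [folklore] -/
theorem sum_card_fiber_eq {m ν : ℕ} (J : Fin m → Fin ν) :
    ∑ b, Fintype.card {l // J l = b} = m := by
  classical
  have h := Fintype.sum_fiberwise J (fun _ => (1 : ℕ))
  simp only [Finset.sum_const, Finset.card_univ, smul_eq_mul, mul_one, Fintype.card_fin] at h
  exact h

/-- **The double-blocking estimate** (proof of CHNVZ Thm 2.2): if
`T^{⊗n} = ∑_{i<ν} α_i S_i^{⊗n}` and `R(S_i^{⊗ℓ}) ≤ C_i ρ^ℓ` for all `i, ℓ`, then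
`R(T^{⊗(m n)}) ≤ ν^m (∏_i C_i) ρ^{m n}` for every `m` — expand `(T^{⊗n})^{⊗m}` into `ν^m`
Kronecker products, regroup equal factors, and apply subadditivity and submultiplicativity.
[cite: ChristandlHoeberechtsNieuwboerVranaZuiddam2025, Theorem 2.2 (proof)] -/
theorem tensorRank_kroneckerPow_mul_le_of_eq_sum {ν : ℕ} (S : Fin ν → ι → κ → μ → F)
    (α : Fin ν → F) (T : ι → κ → μ → F) (n m : ℕ)
    (hrep : kroneckerPow T n = ∑ i, α i • kroneckerPow (S i) n)
    {ρ : ℝ} (C : Fin ν → ℝ)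
    (hC : ∀ i ℓ, (tensorRank (kroneckerPow (S i) ℓ) : ℝ) ≤ C i * ρ ^ ℓ) :
    (tensorRank (kroneckerPow T (m * n)) : ℝ) ≤ (ν : ℝ) ^ m * (∏ i, C i) * ρ ^ (m * n) := by
  classical
  -- (1) `R(T^{⊗(m n)}) ≤ R((T^{⊗n})^{⊗m})` and (2) the multilinear expansion
  have h1 := tensorRank_kroneckerPow_mul_le_pow_pow T m n
  have h2 : kroneckerPow (kroneckerPow T n) m =
      ∑ J : Fin m → Fin ν, kroneckerPi fun l => α (J l) • kroneckerPow (S (J l)) n := by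
    rw [hrep]
    exact kroneckerPow_sum _ _
  -- (3) each of the `ν^m` terms has rank `≤ (∏ C_i) ρ^{m n}` after regrouping
  have h3 : ∀ J : Fin m → Fin ν,
      (tensorRank (kroneckerPi fun l => α (J l) • kroneckerPow (S (J l)) n) : ℝ) ≤
        (∏ i, C i) * ρ ^ (m * n) := by
    intro J
    have hnat : tensorRank (kroneckerPi fun l => α (J l) • kroneckerPow (S (J l)) n) ≤
        ∏ b, tensorRank (kroneckerPow (S b) (Fintype.card {l // J l = b} * n)) := by
      rw [kroneckerPi_smul (fun l => α (J l)) (fun l => kroneckerPow (S (J l)) n)]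
      exact (tensorRank_smul_le _ _).trans (tensorRank_kroneckerPi_le_prod_fiber J n S)
    have hsum : ∑ b, Fintype.card {l // J l = b} * n = m * n := by
      rw [← Finset.sum_mul, sum_card_fiber_eq J]
    calc (tensorRank (kroneckerPi fun l => α (J l) • kroneckerPow (S (J l)) n) : ℝ)
        ≤ ((∏ b, tensorRank (kroneckerPow (S b) (Fintype.card {l // J l = b} * n)) : ℕ) :
            ℝ) := by
          exact_mod_cast hnat
      _ = ∏ b, (tensorRank (kroneckerPow (S b) (Fintype.card {l // J l = b} * n)) : ℝ) := by
          push_cast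
          rfl
      _ ≤ ∏ b, C b * ρ ^ (Fintype.card {l // J l = b} * n) :=
          Finset.prod_le_prod (fun _ _ => Nat.cast_nonneg _) fun b _ => hC b _
      _ = (∏ b, C b) * ρ ^ (∑ b, Fintype.card {l // J l = b} * n) := by
          rw [Finset.prod_mul_distrib, Finset.prod_pow_eq_pow_sum]
      _ = (∏ i, C i) * ρ ^ (m * n) := by rw [hsum]
  -- (4) add up
  calc (tensorRank (kroneckerPow T (m * n)) : ℝ)
      ≤ tensorRank (kroneckerPow (kroneckerPow T n) m) := by exact_mod_cast h1
    _ ≤ ∑ J : Fin m → Fin ν,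
          (tensorRank (kroneckerPi fun l => α (J l) • kroneckerPow (S (J l)) n) : ℝ) := by
        rw [h2]
        exact_mod_cast tensorRank_sum_le Finset.univ _
    _ ≤ ∑ _J : Fin m → Fin ν, (∏ i, C i) * ρ ^ (m * n) := Finset.sum_le_sum fun J _ => h3 J
    _ = (ν : ℝ) ^ m * (∏ i, C i) * ρ ^ (m * n) := by
        rw [Finset.sum_const, Finset.card_univ, Fintype.card_fun, Fintype.card_fin,
          Fintype.card_fin, nsmul_eq_mul]
        push_cast
        ring

end Estimate

/-! ## G. Theorem 1.2 (`k = 3`): the discharge -/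

section Discharge

open MvPolynomial

/-- **Christandl–Hoeberechts–Nieuwboer–Vrana–Zuiddam, Thm 1.2 (order three), proved**: the
sublevel sets `{T : R̃(T) ≤ r}` of the asymptotic rank are Zariski-closed over every field — the
named fact `chnvz_zariskiClosed_asymptoticRank_le` holds. The proof is the printed one
(Lemma 2.3, Thm 2.2, Cor 2.4 of the source): `T^{⊗n} = ∑_{i<ν(n)} α_i S_i^{⊗n}` with
`ν(n) ≤ (n+1)^{dim V}` and `R̃(S_i) ≤ r`, whence `R(T^{⊗(mn)}) ≤ ν(n)^m (∏ C_i) (r+ε)^{mn}`; let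
`m → ∞`, then `n → ∞`.
[cite: ChristandlHoeberechtsNieuwboerVranaZuiddam2025, Theorem 1.2 (Lemma 2.3, Thm 2.2, Cor 2.4)] -/
theorem chnvz_zariskiClosed_asymptoticRank_le_holds : chnvz_zariskiClosed_asymptoticRank_le := by
  intro F _ ι κ μ _ _ _ r T hZ
  classical
  -- `r < 0`: the sublevel set is empty, the constant polynomial `1` vanishes on it but not at `T`
  rcases lt_or_ge r 0 with hr | hr
  · exfalso
    have h1 := hZ 1 fun S hS =>
      absurd (hS.trans_lt hr) (not_lt.2 (asymptoticRank_nonneg S))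
    simp at h1
  -- it suffices to bound `R̃(T)` by `r + δ` for every `δ > 0`
  refine le_of_forall_pos_le_add fun δ hδ => ?_
  set d := Fintype.card (ι × κ × μ) with hd
  set ρ : ℝ := r + δ / 2 with hρ_def
  have hρ : 0 < ρ := by positivity
  have hρ' : ρ < r + δ := by rw [hρ_def]; linarith
  -- choose the inner block length `n` with `(n+1)^d ρ^n < (r+δ)^n`
  obtain ⟨n, hn1, hn⟩ := exists_pow_succ_lt_pow ((one_lt_div hρ).2 hρ') d
  -- Lemma 2.3 and the few-terms representation of `T^{⊗n}`
  obtain ⟨ν, S, α, hν, hSA, hrep⟩ :=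
    exists_eq_sum_smul_kroneckerPow {S | asymptoticRank S ≤ r} n
      (kroneckerPow_mem_span_of_forall_eval_eq_zero {S | asymptoticRank S ≤ r} T
        (fun p hp => hZ p fun S hS => hp S hS) n)
  -- growth constants of the `S_i`
  have hCex : ∀ i, ∃ C : ℝ, 1 ≤ C ∧ ∀ ℓ : ℕ,
      (tensorRank (kroneckerPow (S i) ℓ) : ℝ) ≤ C * ρ ^ ℓ := fun i =>
    exists_const_tensorRank_kroneckerPow_le (S i) hρ
      ((hSA i).trans_lt (by rw [hρ_def]; linarith))
  choose C hC1 hC using hCex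
  -- `ν' = max ν 1` and the ratio `γ = (r+δ)^n / (ν' ρ^n) > 1`
  set ν' : ℕ := max ν 1 with hν'_def
  have hν'pos : (0 : ℝ) < ν' := by exact_mod_cast (le_max_right ν 1)
  have hν'le : (ν' : ℝ) ≤ ((n : ℝ) + 1) ^ d := by
    have h1d : 1 ≤ (n + 1) ^ d := Nat.one_le_pow _ _ (Nat.succ_pos n)
    have : ν' ≤ (n + 1) ^ d := max_le hν h1d
    exact_mod_cast this
  have hkey : (ν' : ℝ) * ρ ^ n < (r + δ) ^ n := by
    have := hν'le.trans_lt hn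
    rw [div_pow, lt_div_iff₀ (pow_pos hρ n)] at this
    exact this
  set γ : ℝ := (r + δ) ^ n / (ν' * ρ ^ n) with hγ_def
  have hγ : 1 < γ := (one_lt_div (by positivity)).2 hkey
  -- choose the number of blocks `m` with `∏ C_i ≤ γ^m`
  obtain ⟨m, hm1, hm⟩ := exists_le_pow_of_one_lt hγ (∏ i, C i)
  have hC0 : ∀ i, 0 ≤ C i := fun i => zero_le_one.trans (hC1 i)
  -- the double-blocking estimate
  have hest := tensorRank_kroneckerPow_mul_le_of_eq_sum S α T n m hrep C hC
  have hprod : 0 ≤ ∏ i, C i := Finset.prod_nonneg fun i _ => hC0 i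
  have hbound : (tensorRank (kroneckerPow T (m * n)) : ℝ) ≤ (r + δ) ^ (m * n) := by
    refine hest.trans ?_
    have hνν' : (ν : ℝ) ≤ ν' := by exact_mod_cast le_max_left ν 1
    calc (ν : ℝ) ^ m * (∏ i, C i) * ρ ^ (m * n)
        ≤ (ν' : ℝ) ^ m * γ ^ m * ρ ^ (m * n) := by
          gcongr
    _ = ((ν' : ℝ) * γ * ρ ^ n) ^ m := by ring
    _ = ((r + δ) ^ n) ^ m := by
          congr 1
          rw [hγ_def]
          field_simp
    _ = (r + δ) ^ (m * n) := by rw [← pow_mul, mul_comm]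
  -- the term `N + 1 = m n` of the infimum defining `R̃(T)` is at most `r + δ`
  have hmn : 1 ≤ m * n := Nat.one_le_iff_ne_zero.2 (Nat.mul_ne_zero (by omega) (by omega))
  show (⨅ N : ℕ, ((tensorRank (kroneckerPow T (N + 1)) : ℝ) ^ ((N : ℝ) + 1)⁻¹)) ≤ r + δ
  refine ciInf_le_of_le ⟨0, ?_⟩ (m * n - 1) ?_
  · rintro _ ⟨N, rfl⟩
    positivity
  · have hsub : m * n - 1 + 1 = m * n := Nat.sub_add_cancel hmn
    have hcast : ((m * n - 1 : ℕ) : ℝ) + 1 = ((m * n : ℕ) : ℝ) := by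
      exact_mod_cast hsub
    rw [hcast, hsub]
    calc ((tensorRank (kroneckerPow T (m * n)) : ℝ)) ^ ((m * n : ℕ) : ℝ)⁻¹
        ≤ ((r + δ) ^ (m * n)) ^ ((m * n : ℕ) : ℝ)⁻¹ :=
          Real.rpow_le_rpow (Nat.cast_nonneg _) hbound (by positivity)
      _ = r + δ := Real.pow_rpow_inv_natCast (by linarith) (by omega)

end Discharge

end Literature.Computability.AlgebraicComplexity

end
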